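import Summits.Ventures.PercRepro.C026AddEdge
import Summits.Ventures.PercRepro.C026TwoTimesCF

/-!
# Hubs at an isolated vertex: the hub invariant and the slice counts (p6, gen 12; Theorem H, part 1)

mine-3's THEOREM H (memo `proofs/MINE3-MONOTONICITY.md` §30 add. 4, INBOX 5475) attaches a new vertex
`v` («a `T`-hub») to the marks in `T ⊆ {a, b, c}` by single edges and expresses the C-026 slack
`Δ_CF(G + v)` through `Δ_CF(G)` and a few counts on `G`.  Here the hub is an ISOLATED vertex `v` of
`V` (`Isolated`) and the hub edges are added one by one with p5's `addEdge`: `hub2 v t₁ t₂`,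
`hub3 v t₁ t₂ t₃` (edge types `Option (Option E)`, `Option (Option (Option E))`).

* **`HubLike`** — the invariant of a graph `H` obtained from `G` by hub edges at `v` in a
  configuration `τ` over `ω`: for `x, y ≠ v`, `x ~_H y ⟺ x ~_G y ∨ (R x ∧ R y)` and
  `x ~_H v ⟺ R x`, where `R x` = «`x` is `G`-joined to a mark whose hub edge is open»;
  `hubLike_base` (the isolated vertex), `HubLike.addEdge` (one more hub edge, by p5's
  `conn_addEdge_open_iff` / `conn_addEdge_closed_iff`); `hubLike_hub2`, `hubLike_hub3`;
* the complement of a hub configuration (`compl_hub2`, `compl_hub3`): the hub states flip;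
* the counts over the hub graph split into the hub-state slices (`card_filter_option2`,
  `card_filter_option3`, from p5's `card_filter_option`), and **`slackCF_hub2_eq`**,
  **`slackCF_hub3_eq`** write `Δ_CF(G + v)` as the sum over the slices of the four slice counts.

`C026HubTwo.lean` ((H1), (H2)) and `C026HubThree.lean` ((H3), Corollary H) evaluate the slices.
-/

namespace PercRepro

open Finset

namespace MultiGraph

section HubLike

variable {V E : Type*} (G : MultiGraph V E)

/-- `v` is **isolated** in `G`: no edge has `v` as an endpoint. -/
def Isolated (v : V) : Prop := ∀ e, G.fst e ≠ v ∧ G.snd e ≠ v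

variable {G}

/-- An isolated vertex is joined to itself only. -/
theorem Isolated.conn_iff {v : V} (hv : G.Isolated v) (ω : Config E) (x : V) :
    G.Conn ω x v ↔ x = v :=
  ⟨fun h => eq_of_conn_of_isolated (fun e _ => hv e) h.symm, fun h => h ▸ Conn.refl G ω v⟩

/-- **The hub invariant**: `H` is `G` with hub edges at `v`, `τ` a configuration of `H` over `ω`;
for `x, y ≠ v`, `x ~_H y ⟺ x ~_G y ∨ (R x ∧ R y)`, and `x ~_H v ⟺ R x`. -/
structure HubLike (G : MultiGraph V E) (v : V) {E' : Type*} (H : MultiGraph V E') (ω : Config E)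
    (τ : Config E') (R : V → Prop) : Prop where
  conn_iff : ∀ x y, x ≠ v → y ≠ v → (H.Conn τ x y ↔ G.Conn ω x y ∨ (R x ∧ R y))
  conn_v_iff : ∀ x, x ≠ v → (H.Conn τ x v ↔ R x)

/-- The base: `G` itself, nothing reaches the isolated `v`. -/
theorem hubLike_base {v : V} (hv : G.Isolated v) (ω : Config E) :
    HubLike G v G ω ω (fun _ => False) where
  conn_iff _ _ _ _ := by simp
  conn_v_iff x hx := by
    rw [hv.conn_iff]
    exact ⟨hx, False.elim⟩

/-- **One more hub edge** `v–t` in the state `s`: the reach grows by «`G`-joined to `t`» when the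
edge is open. -/
theorem HubLike.addEdge {v : V} {E' : Type*} {H : MultiGraph V E'} {ω : Config E} {τ : Config E'}
    {R : V → Prop} (h : HubLike G v H ω τ R) {t : V} (ht : t ≠ v) (s : Bool) :
    HubLike G v (H.addEdge v t) ω (extendOpt s τ)
      (fun x => R x ∨ (s = true ∧ G.Conn ω x t)) where
  conn_iff x y hx hy := by
    cases s with
    | false =>
      rw [conn_addEdge_closed_iff, h.conn_iff x y hx hy]
      simp
    | true =>
      rw [conn_addEdge_open_iff, h.conn_iff x y hx hy, h.conn_v_iff x hx, h.conn_v_iff y hy,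
        h.conn_iff x t hx ht, h.conn_iff y t hy ht]
      simp only [true_and]
      tauto
  conn_v_iff x hx := by
    cases s with
    | false =>
      rw [conn_addEdge_closed_iff, h.conn_v_iff x hx]
      simp
    | true =>
      rw [conn_addEdge_open_iff, h.conn_v_iff x hx, h.conn_iff x t hx ht]
      have h1 : H.Conn τ v v := Conn.refl H τ v
      have h2 : H.Conn τ v t ↔ R t := by
        rw [conn_comm]
        exact h.conn_v_iff t ht
      simp only [h1, h2, true_or, and_true, true_and]
      tauto

variable (G)

/-- **A two-edge hub**: the isolated `v` joined to `t₁` (edge `some none`) and `t₂` (edge `none`). -/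
def hub2 (v t₁ t₂ : V) : MultiGraph V (Option (Option E)) := (G.addEdge v t₁).addEdge v t₂

/-- **A three-edge hub**: `v` joined to `t₁` (edge `some (some none)`), `t₂` (`some none`), `t₃`
(`none`). -/
def hub3 (v t₁ t₂ t₃ : V) : MultiGraph V (Option (Option (Option E))) :=
  ((G.addEdge v t₁).addEdge v t₂).addEdge v t₃

variable {G}

/-- The hub invariant of `hub2` in the hub states `s₁, s₂`. -/
theorem hubLike_hub2 {v t₁ t₂ : V} (hv : G.Isolated v) (ht₁ : t₁ ≠ v) (ht₂ : t₂ ≠ v)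
    (ω : Config E) (s₁ s₂ : Bool) :
    HubLike G v (G.hub2 v t₁ t₂) ω (extendOpt s₂ (extendOpt s₁ ω))
      (fun x => (s₁ = true ∧ G.Conn ω x t₁) ∨ (s₂ = true ∧ G.Conn ω x t₂)) := by
  have h : HubLike G v (G.hub2 v t₁ t₂) ω (extendOpt s₂ (extendOpt s₁ ω))
      (fun x => (False ∨ (s₁ = true ∧ G.Conn ω x t₁)) ∨ (s₂ = true ∧ G.Conn ω x t₂)) :=
    ((hubLike_base hv ω).addEdge ht₁ s₁).addEdge ht₂ s₂
  refine ⟨fun x y hx hy => ?_, fun x hx => ?_⟩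
  · rw [h.conn_iff x y hx hy]
    simp
  · rw [h.conn_v_iff x hx]
    simp

/-- The hub invariant of `hub3` in the hub states `s₁, s₂, s₃`. -/
theorem hubLike_hub3 {v t₁ t₂ t₃ : V} (hv : G.Isolated v) (ht₁ : t₁ ≠ v) (ht₂ : t₂ ≠ v)
    (ht₃ : t₃ ≠ v) (ω : Config E) (s₁ s₂ s₃ : Bool) :
    HubLike G v (G.hub3 v t₁ t₂ t₃) ω (extendOpt s₃ (extendOpt s₂ (extendOpt s₁ ω)))
      (fun x => (s₁ = true ∧ G.Conn ω x t₁) ∨ (s₂ = true ∧ G.Conn ω x t₂) ∨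
        (s₃ = true ∧ G.Conn ω x t₃)) := by
  have h : HubLike G v (G.hub3 v t₁ t₂ t₃) ω (extendOpt s₃ (extendOpt s₂ (extendOpt s₁ ω)))
      (fun x => ((False ∨ (s₁ = true ∧ G.Conn ω x t₁)) ∨ (s₂ = true ∧ G.Conn ω x t₂)) ∨
        (s₃ = true ∧ G.Conn ω x t₃)) :=
    (((hubLike_base hv ω).addEdge ht₁ s₁).addEdge ht₂ s₂).addEdge ht₃ s₃
  refine ⟨fun x y hx hy => ?_, fun x hx => ?_⟩
  · rw [h.conn_iff x y hx hy]
    simp only [false_or, or_assoc]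
  · rw [h.conn_v_iff x hx]
    simp only [false_or, or_assoc]

/-- The complement of a `hub2` configuration: both hub states flip. -/
theorem compl_hub2 (ω : Config E) (s₁ s₂ : Bool) :
    (extendOpt s₂ (extendOpt s₁ ω))ᶜ = extendOpt (!s₂) (extendOpt (!s₁) ωᶜ) := by
  rw [compl_extendOpt, compl_extendOpt]

/-- The complement of a `hub3` configuration: the three hub states flip. -/
theorem compl_hub3 (ω : Config E) (s₁ s₂ s₃ : Bool) :
    (extendOpt s₃ (extendOpt s₂ (extendOpt s₁ ω)))ᶜ =
      extendOpt (!s₃) (extendOpt (!s₂) (extendOpt (!s₁) ωᶜ)) := by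
  rw [compl_extendOpt, compl_extendOpt, compl_extendOpt]

end HubLike

/-! ### Counting over the hub-state slices -/

section Slices

variable {E : Type*} [Fintype E]

open Classical in
/-- A count over `Option (Option E)` is the sum over the four hub states. -/
theorem card_filter_option2 (Q : Config (Option (Option E)) → Prop) [DecidablePred Q] :
    (univ.filter Q).card =
      (univ.filter fun ω : Config E => Q (extendOpt false (extendOpt false ω))).card +
        (univ.filter fun ω : Config E => Q (extendOpt false (extendOpt true ω))).card +
        ((univ.filter fun ω : Config E => Q (extendOpt true (extendOpt false ω))).card +
          (univ.filter fun ω : Config E => Q (extendOpt true (extendOpt true ω))).card) := by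
  rw [card_filter_option Q, card_filter_option, card_filter_option]

open Classical in
/-- A count over `Option (Option (Option E))` is the sum over the eight hub states. -/
theorem card_filter_option3 (Q : Config (Option (Option (Option E))) → Prop) [DecidablePred Q] :
    (univ.filter Q).card =
      ((univ.filter fun ω : Config E => Q (extendOpt false (extendOpt false (extendOpt false ω)))).card +
        (univ.filter fun ω : Config E => Q (extendOpt false (extendOpt false (extendOpt true ω)))).card +
        ((univ.filter fun ω : Config E => Q (extendOpt false (extendOpt true (extendOpt false ω)))).card +
          (univ.filter fun ω : Config E => Q (extendOpt false (extendOpt true (extendOpt true ω)))).card)) +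
      ((univ.filter fun ω : Config E => Q (extendOpt true (extendOpt false (extendOpt false ω)))).card +
        (univ.filter fun ω : Config E => Q (extendOpt true (extendOpt false (extendOpt true ω)))).card +
        ((univ.filter fun ω : Config E => Q (extendOpt true (extendOpt true (extendOpt false ω)))).card +
          (univ.filter fun ω : Config E => Q (extendOpt true (extendOpt true (extendOpt true ω)))).card)) := by
  rw [card_filter_option Q, card_filter_option2, card_filter_option2]

end Slices

section SlackSlices

variable {V E : Type*} [Fintype E] (H : MultiGraph V E)

open Classical in
/-- The four slice counts of `Δ_CF` of a graph `H` at a configuration map `f` (the slice): the cells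
`ab|c`, `ac|b`, `bc|a` and `N_AB` read through `f`. -/
noncomputable def sliceCF {E₀ : Type*} [Fintype E₀] (f : Config E₀ → Config E) (a b c : V) : ℤ :=
  ((univ.filter fun ω : Config E₀ => H.Conn (f ω) a b ∧ ¬ H.Conn (f ω) a c).card : ℤ) +
    ((univ.filter fun ω : Config E₀ => H.Conn (f ω) c a ∧ ¬ H.Conn (f ω) c b).card : ℤ) +
    ((univ.filter fun ω : Config E₀ => H.Conn (f ω) c b ∧ ¬ H.Conn (f ω) c a).card : ℤ) -
    ((univ.filter fun ω : Config E₀ =>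
      H.Conn (f ω) a b ∧ ¬ H.Conn (f ω)ᶜ c a ∧ ¬ H.Conn (f ω)ᶜ c b).card : ℤ)

end SlackSlices

section HubSlack

variable {V E : Type*} [Fintype E] (G : MultiGraph V E)

open Classical in
/-- **`Δ_CF` of a two-edge hub graph is the sum over its four hub-state slices.** -/
theorem slackCF_hub2_eq (v t₁ t₂ a b c : V) :
    (G.hub2 v t₁ t₂).slackCF a b c =
      (G.hub2 v t₁ t₂).sliceCF (fun ω : Config E => extendOpt false (extendOpt false ω)) a b c +
        (G.hub2 v t₁ t₂).sliceCF (fun ω => extendOpt false (extendOpt true ω)) a b c +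
        ((G.hub2 v t₁ t₂).sliceCF (fun ω => extendOpt true (extendOpt false ω)) a b c +
          (G.hub2 v t₁ t₂).sliceCF (fun ω => extendOpt true (extendOpt true ω)) a b c) := by
  have key : ((univ.filter fun τ : Config (Option (Option E)) =>
        (G.hub2 v t₁ t₂).Conn τ a b ∧ ¬ (G.hub2 v t₁ t₂).Conn τ a c).card : ℤ) +
      ((univ.filter fun τ : Config (Option (Option E)) =>
        (G.hub2 v t₁ t₂).Conn τ c a ∧ ¬ (G.hub2 v t₁ t₂).Conn τ c b).card : ℤ) +
      ((univ.filter fun τ : Config (Option (Option E)) =>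
        (G.hub2 v t₁ t₂).Conn τ c b ∧ ¬ (G.hub2 v t₁ t₂).Conn τ c a).card : ℤ) -
      ((univ.filter fun τ : Config (Option (Option E)) =>
        (G.hub2 v t₁ t₂).Conn τ a b ∧ ¬ (G.hub2 v t₁ t₂).Conn τᶜ c a ∧
          ¬ (G.hub2 v t₁ t₂).Conn τᶜ c b).card : ℤ) =
      (G.hub2 v t₁ t₂).sliceCF (fun ω : Config E => extendOpt false (extendOpt false ω)) a b c +
        (G.hub2 v t₁ t₂).sliceCF (fun ω => extendOpt false (extendOpt true ω)) a b c +
        ((G.hub2 v t₁ t₂).sliceCF (fun ω => extendOpt true (extendOpt false ω)) a b c +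
          (G.hub2 v t₁ t₂).sliceCF (fun ω => extendOpt true (extendOpt true ω)) a b c) := by
    unfold sliceCF
    rw [card_filter_option2, card_filter_option2, card_filter_option2, card_filter_option2]
    push_cast
    ring
  unfold slackCF
  convert key using 8

open Classical in
/-- **`Δ_CF` of a three-edge hub graph is the sum over its eight hub-state slices.** -/
theorem slackCF_hub3_eq (v t₁ t₂ t₃ a b c : V) :
    (G.hub3 v t₁ t₂ t₃).slackCF a b c =
      ((G.hub3 v t₁ t₂ t₃).sliceCF
          (fun ω : Config E => extendOpt false (extendOpt false (extendOpt false ω))) a b c +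
        (G.hub3 v t₁ t₂ t₃).sliceCF (fun ω => extendOpt false (extendOpt false (extendOpt true ω))) a b c +
        ((G.hub3 v t₁ t₂ t₃).sliceCF (fun ω => extendOpt false (extendOpt true (extendOpt false ω))) a b c +
          (G.hub3 v t₁ t₂ t₃).sliceCF (fun ω => extendOpt false (extendOpt true (extendOpt true ω))) a b c)) +
      ((G.hub3 v t₁ t₂ t₃).sliceCF (fun ω => extendOpt true (extendOpt false (extendOpt false ω))) a b c +
        (G.hub3 v t₁ t₂ t₃).sliceCF (fun ω => extendOpt true (extendOpt false (extendOpt true ω))) a b c +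
        ((G.hub3 v t₁ t₂ t₃).sliceCF (fun ω => extendOpt true (extendOpt true (extendOpt false ω))) a b c +
          (G.hub3 v t₁ t₂ t₃).sliceCF (fun ω => extendOpt true (extendOpt true (extendOpt true ω))) a b c)) := by
  have key : ((univ.filter fun τ : Config (Option (Option (Option E))) =>
        (G.hub3 v t₁ t₂ t₃).Conn τ a b ∧ ¬ (G.hub3 v t₁ t₂ t₃).Conn τ a c).card : ℤ) +
      ((univ.filter fun τ : Config (Option (Option (Option E))) =>
        (G.hub3 v t₁ t₂ t₃).Conn τ c a ∧ ¬ (G.hub3 v t₁ t₂ t₃).Conn τ c b).card : ℤ) +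
      ((univ.filter fun τ : Config (Option (Option (Option E))) =>
        (G.hub3 v t₁ t₂ t₃).Conn τ c b ∧ ¬ (G.hub3 v t₁ t₂ t₃).Conn τ c a).card : ℤ) -
      ((univ.filter fun τ : Config (Option (Option (Option E))) =>
        (G.hub3 v t₁ t₂ t₃).Conn τ a b ∧ ¬ (G.hub3 v t₁ t₂ t₃).Conn τᶜ c a ∧
          ¬ (G.hub3 v t₁ t₂ t₃).Conn τᶜ c b).card : ℤ) =
      ((G.hub3 v t₁ t₂ t₃).sliceCF
          (fun ω : Config E => extendOpt false (extendOpt false (extendOpt false ω))) a b c +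
        (G.hub3 v t₁ t₂ t₃).sliceCF (fun ω => extendOpt false (extendOpt false (extendOpt true ω))) a b c +
        ((G.hub3 v t₁ t₂ t₃).sliceCF (fun ω => extendOpt false (extendOpt true (extendOpt false ω))) a b c +
          (G.hub3 v t₁ t₂ t₃).sliceCF (fun ω => extendOpt false (extendOpt true (extendOpt true ω))) a b c)) +
      ((G.hub3 v t₁ t₂ t₃).sliceCF (fun ω => extendOpt true (extendOpt false (extendOpt false ω))) a b c +
        (G.hub3 v t₁ t₂ t₃).sliceCF (fun ω => extendOpt true (extendOpt false (extendOpt true ω))) a b c +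
        ((G.hub3 v t₁ t₂ t₃).sliceCF (fun ω => extendOpt true (extendOpt true (extendOpt false ω))) a b c +
          (G.hub3 v t₁ t₂ t₃).sliceCF (fun ω => extendOpt true (extendOpt true (extendOpt true ω))) a b c)) := by
    unfold sliceCF
    rw [card_filter_option3, card_filter_option3, card_filter_option3, card_filter_option3]
    push_cast
    ring
  unfold slackCF
  convert key using 8

end HubSlack

/-! ### Slices through the hub invariant -/

section Slice

variable {V E : Type*} [Fintype E] {G : MultiGraph V E}

open Classical in
/-- **The complement bijection**: a count of a predicate in `ω` is the count of the predicate in `ωᶜ`. -/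
theorem card_filter_compl (P : Config E → Prop) :
    (univ.filter fun ω : Config E => P ω).card = (univ.filter fun ω : Config E => P ωᶜ).card := by
  refine Finset.card_nbij' (fun ω => ωᶜ) (fun ω => ωᶜ) ?_ ?_ ?_ ?_
  · intro ω hω
    simp only [Finset.coe_filter, Finset.mem_univ, true_and, Set.mem_setOf_eq, compl_compl] at hω ⊢
    exact hω
  · intro ω hω
    simp only [Finset.coe_filter, Finset.mem_univ, true_and, Set.mem_setOf_eq] at hω ⊢
    exact hω
  · intro ω _
    exact compl_compl ω
  · intro ω _
    exact compl_compl ω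

open Classical in
/-- **A slice through the hub invariant**: the four slice counts of `H` at `f` read in `G`, with the
open reach `R` and the closed reach `R'`. -/
theorem sliceCF_eq_of_hubLike {E' : Type*} [Fintype E'] {H : MultiGraph V E'}
    {f : Config E → Config E'} {R R' : Config E → V → Prop} {v a b c : V} (hav : a ≠ v)
    (hbv : b ≠ v) (hcv : c ≠ v) (hH : ∀ ω, HubLike G v H ω (f ω) (R ω))
    (hH' : ∀ ω, HubLike G v H ωᶜ (f ω)ᶜ (R' ω)) :
    H.sliceCF f a b c =
      ((univ.filter fun ω : Config E =>
          (G.Conn ω a b ∨ (R ω a ∧ R ω b)) ∧ ¬ (G.Conn ω a c ∨ (R ω a ∧ R ω c))).card : ℤ) +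
        ((univ.filter fun ω : Config E =>
          (G.Conn ω c a ∨ (R ω c ∧ R ω a)) ∧ ¬ (G.Conn ω c b ∨ (R ω c ∧ R ω b))).card : ℤ) +
        ((univ.filter fun ω : Config E =>
          (G.Conn ω c b ∨ (R ω c ∧ R ω b)) ∧ ¬ (G.Conn ω c a ∨ (R ω c ∧ R ω a))).card : ℤ) -
        ((univ.filter fun ω : Config E =>
          (G.Conn ω a b ∨ (R ω a ∧ R ω b)) ∧ ¬ (G.Conn ωᶜ c a ∨ (R' ω c ∧ R' ω a)) ∧
            ¬ (G.Conn ωᶜ c b ∨ (R' ω c ∧ R' ω b))).card : ℤ) := by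
  have e1 : ∀ ω, H.Conn (f ω) a b ↔ G.Conn ω a b ∨ (R ω a ∧ R ω b) := fun ω =>
    (hH ω).conn_iff a b hav hbv
  have e2 : ∀ ω, H.Conn (f ω) a c ↔ G.Conn ω a c ∨ (R ω a ∧ R ω c) := fun ω =>
    (hH ω).conn_iff a c hav hcv
  have e3 : ∀ ω, H.Conn (f ω) c a ↔ G.Conn ω c a ∨ (R ω c ∧ R ω a) := fun ω =>
    (hH ω).conn_iff c a hcv hav
  have e4 : ∀ ω, H.Conn (f ω) c b ↔ G.Conn ω c b ∨ (R ω c ∧ R ω b) := fun ω =>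
    (hH ω).conn_iff c b hcv hbv
  have e5 : ∀ ω, H.Conn (f ω)ᶜ c a ↔ G.Conn ωᶜ c a ∨ (R' ω c ∧ R' ω a) := fun ω =>
    (hH' ω).conn_iff c a hcv hav
  have e6 : ∀ ω, H.Conn (f ω)ᶜ c b ↔ G.Conn ωᶜ c b ∨ (R' ω c ∧ R' ω b) := fun ω =>
    (hH' ω).conn_iff c b hcv hbv
  unfold sliceCF
  simp only [e1, e2, e3, e4, e5, e6]

end Slice

end MultiGraph

end PercRepro
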